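import Mathlib
import Summits.Ventures.YMGap.FlowData.GalerkinRoundingModel
import Summits.Ventures.YMGap.FlowData.SymmetrisedBlockTransport
import HarnessLib

/-!
# The build-rounding model of the lineage-A block certificate, III: the composed statement

HONEST FRAMING: composition only — the rounded-tree model (`GalerkinRoundingModel`: `|fl − exact| ≤ 3cu · float
absolute accumulation` under the standard model) with the symmetrised-block transport (`SymmetrisedBlockTransport`):
for a block whose exact entries, float entries and float absolute accumulation are given by the SAME shapes, the
eigenvalues of the symmetrised float block are within `errG` of the exact ones for every
`errG ≥ 3cu · Σⱼ (A i j + A j i)/2`, and — the engine's printed form — for every `errG ≥ 4Nu · Σⱼ (A i j + A j i)/2` once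
`c ≤ N` (`abs_eigenvalues₀_sub_le_of_engine_constant`).  This is ENGINE.md §3 (iii) step (0) of the Y3 FLOW-DATA lineage-A
engine `sntm` as one theorem; the rounding count `c ≤ N`, the unit roundoff `u` and the shapes are a run's audit witness
(sntm v2.4.3 prints it as `rounding_count`, ENGINE.md §14).  No lattice
number, continuum or Clay statement is touched.

Namespace `Summit.Ventures.YMGap.FlowData.GalerkinRounding`.

## References
* [Higham2002ASNA] N. J. Higham, *Accuracy and Stability of Numerical Algorithms*, 2nd ed., SIAM 2002 — Lemma 3.1, §3.3.
* [HornJohnson2013] R. A. Horn, C. R. Johnson, *Matrix Analysis*, 2nd ed., CUP 2013 — Thm 4.3.1 (Weyl).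
-/

noncomputable section

open Matrix Finset

namespace Summit.Ventures.YMGap.FlowData

namespace GalerkinRounding

section Composed

variable {ι ν : Type*} {m : Type*} [Fintype m] [DecidableEq m]

/-- **ENGINE.md §3 (iii) step (0), typed.** Let every entry of the exact Galerkin block be the exact value of a
shape, `G i j = eval x 0 (T i j)`, the float block the same shapes run with rounding errors `|δ| ≤ u`,
`M₀ i j = eval x (δ i j) (T i j)`, and `A` the float absolute accumulation `A i j = eval |x| (δ' i j) (T i j)`,
`|δ'| ≤ u`; let all counts be `≤ c` with `u ≤ 1/16`, `c·u ≤ 1/16`, and let `G` be symmetric.  Then the eigenvalues of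
the symmetrised float block are within `errG` of those of `G` for every `errG ≥ 3cu · Σⱼ (A i j + A j i)/2`.
[cite: Higham2002ASNA, Lemma 3.1; §3.3] [cite: HornJohnson2013, Thm 4.3.1] -/
theorem abs_eigenvalues₀_sub_le_of_shapes {u : ℝ} (hu : 0 ≤ u) (hu16 : u ≤ 1 / 16) {c : ℕ}
    (hc : (c : ℝ) * u ≤ 1 / 16) (x : ι → ℝ) (T : m → m → Shape ι ν) (hT : ∀ i j, (T i j).count ≤ c)
    (δ δ' : m → m → ν → ℝ) (hδ : ∀ i j n, |δ i j n| ≤ u) (hδ' : ∀ i j n, |δ' i j n| ≤ u)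
    {G M₀ A : Matrix m m ℝ} (hG : G.IsHermitian) (hGT : ∀ i j, G i j = (T i j).eval x 0)
    (hM₀ : ∀ i j, M₀ i j = (T i j).eval x (δ i j)) (hA : ∀ i j, A i j = (T i j).eval (fun l => |x l|) (δ' i j))
    {errG : ℝ} (herr : ∀ i, 3 * c * u * ∑ j, (A i j + A j i) / 2 ≤ errG) (k : Fin (Fintype.card m)) :
    |hG.eigenvalues₀ k - (isHermitian_symmetrise M₀).eigenvalues₀ k| ≤ errG := by
  refine abs_eigenvalues₀_sub_le_of_symmetrised hG A (κ := 3 * c * u) (fun i j => ?_) herr k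
  rw [hM₀, hGT, hA]
  exact Shape.abs_eval_sub_eval_zero_le_linear hu hu16 hc (hδ i j) (hδ' i j) x (T i j) (hT i j)

/-- **The engine's printed constant.** Same setting; if the count bound `c` is at most the engine's proxy `N` (the run's audit
witness `rounding_count`, ENGINE.md §14) then any `errG ≥ 4·N·u · Σⱼ (A i j + A j i)/2` (all `i`) — the constant `cB = 4·N·u` that
`kit_build.cert_eigs` prints, applied to the symmetrised absolute accumulation — is admissible, because `3cu ≤ 4Nu` and the float
absolute accumulation is entrywise non-negative. [cite: Higham2002ASNA, Lemma 3.1; §3.3] [cite: HornJohnson2013, Thm 4.3.1] -/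
theorem abs_eigenvalues₀_sub_le_of_engine_constant {u : ℝ} (hu : 0 ≤ u) (hu16 : u ≤ 1 / 16) {c : ℕ}
    (hc : (c : ℝ) * u ≤ 1 / 16) {N : ℝ} (hN : (c : ℝ) ≤ N) (x : ι → ℝ) (T : m → m → Shape ι ν)
    (hT : ∀ i j, (T i j).count ≤ c) (δ δ' : m → m → ν → ℝ) (hδ : ∀ i j n, |δ i j n| ≤ u) (hδ' : ∀ i j n, |δ' i j n| ≤ u)
    {G M₀ A : Matrix m m ℝ} (hG : G.IsHermitian) (hGT : ∀ i j, G i j = (T i j).eval x 0)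
    (hM₀ : ∀ i j, M₀ i j = (T i j).eval x (δ i j)) (hA : ∀ i j, A i j = (T i j).eval (fun l => |x l|) (δ' i j))
    {errG : ℝ} (herr : ∀ i, 4 * N * u * ∑ j, (A i j + A j i) / 2 ≤ errG) (k : Fin (Fintype.card m)) :
    |hG.eigenvalues₀ k - (isHermitian_symmetrise M₀).eigenvalues₀ k| ≤ errG := by
  refine abs_eigenvalues₀_sub_le_of_shapes hu hu16 hc x T hT δ δ' hδ hδ' hG hGT hM₀ hA (fun i => ?_) k
  have hApos : ∀ i j, 0 ≤ A i j := fun i j => by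
    rw [hA]
    exact Shape.eval_nonneg (fun l => abs_nonneg (x l)) (fun n => by linarith [(abs_le.mp (hδ' i j n)).1]) _
  have hS : 0 ≤ ∑ j, (A i j + A j i) / 2 :=
    Finset.sum_nonneg fun j _ => by linarith [hApos i j, hApos j i]
  have hc0 : (0 : ℝ) ≤ c := Nat.cast_nonneg c
  have hcN : 3 * (c : ℝ) * u ≤ 4 * N * u := by nlinarith [hc0, hu, hN]
  exact (mul_le_mul_of_nonneg_right hcN hS).trans (herr i)

end Composed

end GalerkinRounding

end Summit.Ventures.YMGap.FlowData

end
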